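/-
Literature/NumberTheory/ComplexMultiplication/DegenerateCMTypesAbelianKernelsRankFormula.lean — pub-hodgecm2 (COR-CM), KEPT Literature lane
lit-deligne-3 gen 66, file F66k.  THEOREMS ONLY (no `def`, no named fact, no `sorry`, no instance, no notation; D-0026 net debt 0).  HC_CM is NOT proved.
-/
import Literature.NumberTheory.ComplexMultiplication.DegenerateCMTypesAbelianKernelsExponentFourOdd
import Literature.NumberTheory.ComplexMultiplication.DegenerateCMTypesAbelianKernelsIndexTwoPowerOdd
import Literature.AlgebraicGeometry.ComplexMultiplication.AbelianTwoPowerCMTypes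
import HarnessLib

/-!
# THE RANK OF A CM TYPE OF ANY FINITE ABELIAN GROUP, BY KERNELS: exponent `2^{K+1}·m` (`m` odd),
# `rank(T) + #B₂ + Σ_{2 ≤ j ≤ K+1} φ(2^j)·#B_{2^j} + Σ_{1 ≤ j ≤ K+1} Σ_{d ∣ m, d ≠ 1} φ(2^j d)·#B_{2^j d} = |G|/2 + 1`, every class decided

Topic `Literature/NumberTheory/ComplexMultiplication` (namespace `Literature.NumberTheory.ComplexMultiplication.CyclicCMType.AbelianKernels`); cell `pub-hodgecm2`
(COR-CM), KEPT Literature lane `lit-deligne-3` gen 66, file F66k — the GROUP-LEVEL CAPSTONE of the lane's abelian programme: Kubota's defect of a CM type of an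
ARBITRARY finite abelian group (exponent `2^{K+1}m`, `m` odd) regrouped by kernels, the index classes `2^j·d` (`1 ≤ j ≤ K+1`, `d ∣ m`) ALL decided: `2` by even
splitting (Dodson), `2^j` (`j ≥ 2`, cyclic quotient) by halving every coset (Yanai; the tree's `AbelianTwoPower.equidistributed_of_sum_eq_zero` in coset form,
**`sum_char_eq_zero_iff_forall_two_mul_card_eq_of_index_two_pow`**), `2^j d` (`d ≠ 1`, cyclic quotient) by vanishing mixed differences along the prime torsion of
the odd part from every base point (the lane's F66j).  The special exponents `2m`, `4m` are the lane's F66e, F66g.  KERNEL ONLY: theorems; no `def`, no named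
fact, no instance, no notation (D-0014 ∕ D-0026 net debt `0`).  HC_CM is NOT proved here or anywhere in the lane.

## Mathematics

T. Kubota [Kubota1965], §4 LEMMA 2, grouped by kernels (S. P. White; tree `typeRank_add_sum_totient_eq`): `rank(T) + Σ_H φ([G:H]) = |G|/2 + 1` over the
ADMISSIBLE kernels `H ∌ ρ` (`G/H` cyclic, all characters of kernel `H` vanishing on `T`).  If `g^{2^{K+1}m} = 1` on `G`, an admissible kernel has index
`2^j d` with `1 ≤ j ≤ K+1`, `d ∣ m` (`j = v₂([G:H])`, `d` the odd part; **`index_eq_two_pow_mul_of_exponent`**), and the vanishing is decided class by class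
([Dodson1984] §3.1.1; [Yanai2015IndexDegeneracy] ∕ [Gordon1999HodgeAVSurvey] 9.4.3; [Hazama2003CyclicCM] Lemma 4.6.1 with multiplicities, [LamLeung2000]
Thm. 2.2, [Washington1997] Thm. 2.5).  Hence, EXACTLY (**`typeRank_add_card_kernels_eq_of_exponent`**),

  `rank(T) + #B₂(T) + Σ_{j=2}^{K+1} φ(2^j)·#B_{2^j}(T) + Σ_{j=1}^{K+1} Σ_{d ∣ m, d ≠ 1} φ(2^j d)·#B_{2^j,d}(T) = |G|/2 + 1`

with `B₂` = index-`2` subgroups `H ∌ ρ` splitting `T` evenly; `B_{2^j}` = index-`2^j` subgroups `H ∌ ρ` with cyclic quotient meeting every coset in `|H|/2`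
elements of `T`; `B_{2^j,d}` = index-`2^j d` subgroups `H ∌ ρ` with cyclic quotient at which `Σ_{ε∈{0,1}^{primes(d)}} (−1)^{|ε|} #(T ∩ g·Π_{ε_q=1}x_q·H) = 0`
for all `g ∈ G` and all `x_q` with `x_q^q ∈ H`; and `T` is NONDEGENERATE iff all these sets are empty (**`typeRank_eq_iff_of_exponent`**).

* §0 helpers (suffix `_rk`): `card_filter_univ_eq_card_rk`, **`sum_char_eq_zero_iff_forall_two_mul_card_eq_of_index_two_pow`**, `forall_…`;
  **`index_eq_two_pow_mul_of_exponent`**.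
* §1 the formula and the criterion (fibrewise sum over the class map `H ↦ (v₂[G:H], oddpart[G:H]) ∈ [1, K+1] × divisors(m)`).

PRESEARCH (lane rule): as for F66e ∕ F66g ∕ F66j (corpus hybrid + vector, galaxy «degenerate CM type | rank of a CM-type | index of degeneracy», all stars,
lane queries gen 64–66): the fully decided kernel count for an arbitrary finite abelian group is not found as printed; the cyclic case is Hazama's
[Hazama2003CyclicCM] Thm. 4.8, the `2`-group case the tree's `AbelianTwoPower.typeRank_add_ncard_equidistributed`; recorded as the lane's own elementary theorem
with the citations above.

HONEST REGISTER.  Unconditional and elementary given the tree; nothing is claimed about the Hodge classes of degenerate types.  HC_CM is NOT proved and not used.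

## References

* [Kubota1965] T. Kubota, *On the field extension by complex multiplication*, Trans. AMS 118 (1965), §4 Lemma 2.
* [White1993SporadicCycles] S. P. White, *Sporadic cycles on CM abelian varieties*, Compositio Math. 88 (1993), §4, proof of Lemma 3 (p. 131).
* [Dodson1984] B. Dodson, *The structure of Galois groups of CM-fields*, Trans. AMS 283 (1984), §3.1.1 Theorem.
* [Yanai2015IndexDegeneracy] H. Yanai, *On degenerate CM-types*, J. Number Theory 152 (2015), Thm. 4.1.
* [Gordon1999HodgeAVSurvey] B. B. Gordon, *A survey of the Hodge conjecture for abelian varieties* (1999), 9.4.3 (Theorem [B.140]).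
* [Hazama2003CyclicCM] F. Hazama, J. Math. Sci. Univ. Tokyo 10 (2003): Prop. 4.3, Lemma 4.6.1, Thm. 4.8.
* [LamLeung2000] T. Y. Lam, K. H. Leung, *On vanishing sums of roots of unity*, J. Algebra 224 (2000), Thm. 2.2.
* [Washington1997] L. C. Washington, *Introduction to Cyclotomic Fields*, 2nd ed., GTM 83, Ch. 2, Thm. 2.5.

## Provenance

Cell `pub-hodgecm2` (COR-CM), KEPT Literature lane `lit-deligne-3` gen 66 (claim ABELIAN-RANK-FORMULA-GENERAL; count-neutral, own lane), file F66k; neighbours cited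
by name, nothing restated: `DegenerateCMTypesAbelianKernels` (`typeRank_add_sum_totient_eq`, `…iff_of_index_two`, `exists_oddChar_ker`, `forall_sum_char_eq_zero_iff_exists`),
`DegenerateCMTypesAbelianPrimePower` (`AbelianPrimePow.card_filter_neg`, `card_fibre_mul`), `AlgebraicGeometry/ComplexMultiplication/AbelianTwoPowerCMTypes`
(`equidistributed_of_sum_eq_zero`, `sum_eq_zero_of_equidistributed`), `DegenerateCMTypesAbelianKernelsIndexTwoPowerOdd` (F66j `…_of_index_two_pow_mul_odd`).
Theorems only; net Literature debt 0.
-/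

noncomputable section

open scoped BigOperators Classical

namespace Literature.NumberTheory.ComplexMultiplication

namespace CyclicCMType

namespace AbelianKernels

open Literature.AlgebraicGeometry.ComplexMultiplication.AbelianTwoPower (equidistributed_of_sum_eq_zero sum_eq_zero_of_equidistributed)

variable {G : Type*} [CommGroup G] [Fintype G] [DecidableEq G] {ρ : G} {T : Finset G} {m K : ℕ}

/-! ## §0 Helpers: the `2`-power kernels in coset form; the admissible indices -/

section Helpers

omit [Fintype G] [DecidableEq G] in
/-- `χ(gh) = χ(g)χ(h)`. [folklore] -/
private theorem char_mul_rk (χ : AddChar (Additive G) ℂ) (g h : G) :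
    χ (Additive.ofMul (g * h)) = χ (Additive.ofMul g) * χ (Additive.ofMul h) := by
  rw [ofMul_mul, AddChar.map_add_eq_mul]

omit [Fintype G] [DecidableEq G] in
/-- `χ(g^e) = χ(g)^e`. [folklore] -/
private theorem char_pow_rk (χ : AddChar (Additive G) ℂ) (g : G) (e : ℕ) :
    χ (Additive.ofMul (g ^ e)) = χ (Additive.ofMul g) ^ e := by
  rw [ofMul_pow, AddChar.map_nsmul_eq_pow]

omit [Fintype G] [DecidableEq G] in
/-- `χ(1) = 1`. [folklore] -/
private theorem char_one_rk (χ : AddChar (Additive G) ℂ) : χ (Additive.ofMul (1 : G)) = 1 := by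
  rw [ofMul_one, AddChar.map_zero_eq_one]

omit [Fintype G] [DecidableEq G] in
/-- `χ(g) ≠ 0`. [folklore] -/
private theorem char_ne_zero_rk (χ : AddChar (Additive G) ℂ) (g : G) : χ (Additive.ofMul g) ≠ 0 := by
  intro h0
  have := char_mul_rk χ g g⁻¹
  rw [mul_inv_cancel, char_one_rk, h0, zero_mul] at this
  exact one_ne_zero this

omit [Fintype G] [DecidableEq G] in
/-- `χ(s) = χ(g)` iff `g⁻¹s ∈ ker χ`. [folklore] -/
private theorem char_eq_iff_inv_mul_mem_rk {H : Subgroup G} (χ : AddChar (Additive G) ℂ)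
    (hker : ∀ g : G, χ (Additive.ofMul g) = 1 ↔ g ∈ H) (g s : G) :
    χ (Additive.ofMul s) = χ (Additive.ofMul g) ↔ g⁻¹ * s ∈ H := by
  rw [← hker]
  have h1 : χ (Additive.ofMul (g⁻¹ * s)) * χ (Additive.ofMul g) = χ (Additive.ofMul s) := by
    rw [← char_mul_rk, mul_comm g⁻¹ s, inv_mul_cancel_right]
  constructor
  · intro hs
    rw [hs] at h1
    exact mul_left_eq_self₀.1 h1 |>.resolve_right (char_ne_zero_rk χ g)
  · intro h
    rw [h, one_mul] at h1
    exact h1.symm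

omit [Fintype G] [DecidableEq G] in
/-- `ρ² = 1` for the conjugation of a CM type. [folklore] -/
private theorem rho_mul_rho_rk (h : IsCMTypeWith ρ (T : Set G)) : ρ * ρ = 1 := by
  simpa [smul_eq_mul] using h.invol (1 : G)

omit [Fintype G] [DecidableEq G] in
/-- A character whose kernel misses `ρ` is odd. [folklore] -/
private theorem odd_of_ker_rk {H : Subgroup G} (hρH : ρ ∉ H) (hρ2 : ρ * ρ = 1) (χ : AddChar (Additive G) ℂ)
    (hker : ∀ g : G, χ (Additive.ofMul g) = 1 ↔ g ∈ H) : χ (Additive.ofMul ρ) = -1 := by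
  have hsq : χ (Additive.ofMul ρ) * χ (Additive.ofMul ρ) = 1 := by rw [← char_mul_rk, hρ2, char_one_rk]
  rcases mul_self_eq_one_iff.1 hsq with h1 | h1
  · exact absurd ((hker ρ).1 h1) hρH
  · exact h1

omit [DecidableEq G] in
/-- `#{t : χ(t) = 1} = |ker χ|`. [folklore] -/
private theorem card_filter_univ_eq_card_rk {H : Subgroup G} (χ : AddChar (Additive G) ℂ) (hker : ∀ g : G, χ (Additive.ofMul g) = 1 ↔ g ∈ H) :
    (Finset.univ.filter fun t : G => χ (Additive.ofMul t) = 1).card = Nat.card H := by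
  have hHc : (H : Set G) = ↑(Finset.univ.filter fun t : G => χ (Additive.ofMul t) = 1) := by
    ext t
    simp only [SetLike.mem_coe, Finset.coe_filter, Finset.mem_univ, true_and, Set.mem_setOf_eq]
    exact (hker t).symm
  have hH : Nat.card H = (H : Set G).ncard := Nat.card_coe_set_eq (H : Set G)
  rw [hH, hHc, Set.ncard_coe_finset]

/-- **KERNELS OF INDEX `2^{n+1}` (CYCLIC QUOTIENT): THE CHARACTER VANISHES IFF THE TYPE HALVES EVERY COSET** (`n ≥ 1`, i.e. index `≥ 4`; index `4` is the
tree's `…iff_of_index_four`): for a CM type `S`, `H ∌ ρ` of index `2^{n+1}` with `G/H` cyclic and `ker χ = H`, `Σ_{s∈S} χ(s) = 0 ⟺ 2·#(S ∩ gH) = |H|` for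
all `g`.  The values of `χ` are `2^{n+1}`-th roots of unity, so vanishing forces equidistribution over `χ` (tree `AbelianTwoPower.equidistributed_of_sum_eq_zero`:
`1, ω, …, ω^{2^n−1}` are `ℚ`-independent), and `#(S ∩ χ⁻¹(v)) + #(S ∩ χ⁻¹(−v)) = |H|` for a CM type. [cite: Kubota1965, §4 Lemma 2]
[cite: Gordon1999HodgeAVSurvey, 9.4.3 (Theorem [B.140])] -/
theorem sum_char_eq_zero_iff_forall_two_mul_card_eq_of_index_two_pow (h : IsCMTypeWith ρ (T : Set G)) {H : Subgroup G} (hρH : ρ ∉ H)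
    (χ : AddChar (Additive G) ℂ) (hker : ∀ g : G, χ (Additive.ofMul g) = 1 ↔ g ∈ H) {n : ℕ} (hidx : H.index = 2 ^ (n + 1)) :
    ∑ s ∈ T, χ (Additive.ofMul s) = 0 ↔ ∀ g : G, 2 * (T.filter fun s => g⁻¹ * s ∈ H).card = Nat.card H := by
  have hρ2 := rho_mul_rho_rk h
  have hχρ : χ (Additive.ofMul ρ) = -1 := odd_of_ker_rk hρH hρ2 χ hker
  have hχpow : ∀ g : G, χ (Additive.ofMul g) ^ 2 ^ (n + 1) = 1 := fun g => by
    rw [← char_pow_rk, hker, ← hidx]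
    exact H.pow_index_mem g
  have hcos : ∀ g : G, (T.filter fun s => g⁻¹ * s ∈ H) = T.filter fun s => χ (Additive.ofMul s) = χ (Additive.ofMul g) := fun g =>
    Finset.filter_congr fun s _ => (char_eq_iff_inv_mul_mem_rk χ hker g s).symm
  have hM : ∀ g : G, (Finset.univ.filter fun t : G => χ (Additive.ofMul t) = χ (Additive.ofMul g)).card = Nat.card H := fun g => by
    rw [← card_filter_univ_eq_card_rk χ hker, ← AbelianPrimePow.card_fibre_mul χ g 1, mul_one]
  have hle : ∀ g : G, (T.filter fun s => χ (Additive.ofMul s) = χ (Additive.ofMul g)).card ≤ Nat.card H := fun g => by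
    rw [← hM g]
    exact Finset.card_le_card (Finset.filter_subset_filter _ (Finset.subset_univ T))
  have hpair : ∀ g : G, (T.filter fun s => χ (Additive.ofMul s) = χ (Additive.ofMul g)).card +
      (T.filter fun s => χ (Additive.ofMul s) = -χ (Additive.ofMul g)).card = Nat.card H := fun g => by
    rw [AbelianPrimePow.card_filter_neg h χ hχρ, hM, Nat.add_sub_cancel' (hle g)]
  constructor
  · intro h0 g
    have heq := equidistributed_of_sum_eq_zero χ hχpow T h0 g
    have hp := hpair g
    rw [hcos g]
    omega
  · intro hall
    refine sum_eq_zero_of_equidistributed χ T fun g => ?_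
    have h1 := hall g
    have h2 := hall (ρ * g)
    rw [hcos] at h1 h2
    rw [char_mul_rk, hχρ, neg_one_mul] at h2
    have hp := hpair g
    omega

omit [DecidableEq G] in
/-- **All characters of an index-`2^{n+1}` kernel with cyclic quotient at once**: they vanish on `S` iff `S` halves every coset of `H`.
[cite: Kubota1965, §4 Lemma 2] [cite: Gordon1999HodgeAVSurvey, 9.4.3 (Theorem [B.140])] [cite: White1993SporadicCycles, §4, proof of Lemma 3 (p. 131)] -/
theorem forall_sum_char_eq_zero_iff_forall_two_mul_card_eq_of_index_two_pow (h : IsCMTypeWith ρ (T : Set G)) {H : Subgroup G} (hρH : ρ ∉ H)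
    {n : ℕ} (hidx : H.index = 2 ^ (n + 1)) (hcyc : IsCyclic (G ⧸ H)) :
    (∀ χ : AddChar (Additive G) ℂ, (∀ g : G, χ (Additive.ofMul g) = 1 ↔ g ∈ H) → ∑ s ∈ T, χ (Additive.ofMul s) = 0) ↔
      ∀ g : G, 2 * (T.filter fun s => g⁻¹ * s ∈ H).card = Nat.card H := by
  have hρ2 := rho_mul_rho_rk h
  rw [forall_sum_char_eq_zero_iff_exists hρH hρ2 hcyc T]
  constructor
  · rintro ⟨ψ, hψ, h0⟩
    exact (sum_char_eq_zero_iff_forall_two_mul_card_eq_of_index_two_pow h hρH ψ hψ hidx).1 h0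
  · intro hsep
    obtain ⟨χ, -, hker⟩ := exists_oddChar_ker hρH hρ2 hcyc
    exact ⟨χ, hker, (sum_char_eq_zero_iff_forall_two_mul_card_eq_of_index_two_pow h hρH χ hker hidx).2 hsep⟩

omit [Fintype G] [DecidableEq G] in
/-- **The admissible kernels of a finite abelian group killed by `2^{K+1}m` (`m` odd)**: a subgroup `H ∌ ρ` with cyclic quotient has index `2^j·d` with
`j = v₂([G:H]) ∈ [1, K+1]` and `d` = the odd part of `[G:H]`, a divisor of `m`. [cite: Kubota1965, §4 Lemma 2] [cite: White1993SporadicCycles, §4, proof of Lemma 3 (p. 131)] -/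
theorem index_eq_two_pow_mul_of_exponent [Finite G] (hodd : ¬ 2 ∣ m) (hexp : ∀ g : G, g ^ (2 ^ (K + 1) * m) = 1) {H : Subgroup G} (hρH : ρ ∉ H)
    (hρ2 : ρ * ρ = 1) (hcyc : IsCyclic (G ⧸ H)) :
    H.index = 2 ^ (H.index.factorization 2) * ordCompl[2] H.index ∧ ¬ 2 ∣ ordCompl[2] H.index ∧
      H.index.factorization 2 ∈ Finset.Icc 1 (K + 1) ∧ ordCompl[2] H.index ∣ m := by
  haveI := hcyc
  have hn0 : H.index ≠ 0 := Subgroup.index_ne_zero_of_finite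
  have hdvd : H.index ∣ 2 ^ (K + 1) * m := by
    rw [Subgroup.index_eq_card, ← IsCyclic.exponent_eq_card]
    exact Monoid.exponent_dvd_of_forall_pow_eq_one fun x => QuotientGroup.induction_on x fun g => by
      rw [← QuotientGroup.mk_pow, hexp, QuotientGroup.mk_one]
  have h2 : 2 ∣ H.index := by
    have hρ1 : (ρ : G ⧸ H) ≠ 1 := fun h => hρH ((QuotientGroup.eq_one_iff ρ).1 h)
    have hord : orderOf (ρ : G ⧸ H) = 2 := by
      haveI : Fact (Nat.Prime 2) := ⟨Nat.prime_two⟩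
      refine orderOf_eq_prime ?_ hρ1
      rw [pow_two, ← QuotientGroup.mk_mul, hρ2, QuotientGroup.mk_one]
    rw [Subgroup.index_eq_card, ← hord]
    exact orderOf_dvd_natCard _
  have heq : H.index = 2 ^ (H.index.factorization 2) * ordCompl[2] H.index := (Nat.ordProj_mul_ordCompl_eq_self _ 2).symm
  have hdodd : ¬ 2 ∣ ordCompl[2] H.index := Nat.not_dvd_ordCompl Nat.prime_two hn0
  have hcop2m : Nat.Coprime 2 m := (Nat.Prime.coprime_iff_not_dvd Nat.prime_two).2 hodd
  refine ⟨heq, hdodd, Finset.mem_Icc.2 ⟨Nat.one_le_iff_ne_zero.2 (Nat.Prime.factorization_pos_of_dvd Nat.prime_two hn0 h2).ne', ?_⟩, ?_⟩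
  · have h1 : 2 ^ (H.index.factorization 2) ∣ 2 ^ (K + 1) * m := (Nat.ordProj_dvd _ _).trans hdvd
    have h2' : 2 ^ (H.index.factorization 2) ∣ 2 ^ (K + 1) := (Nat.Coprime.pow_left _ hcop2m).dvd_of_dvd_mul_right h1
    exact (Nat.pow_dvd_pow_iff_le_right (by norm_num)).1 h2'
  · have h1 : ordCompl[2] H.index ∣ 2 ^ (K + 1) * m := (Nat.ordCompl_dvd _ _).trans hdvd
    have hc : Nat.Coprime (ordCompl[2] H.index) (2 ^ (K + 1)) :=
      Nat.Coprime.pow_right _ ((Nat.Prime.coprime_iff_not_dvd Nat.prime_two).2 hdodd).symm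
    exact hc.dvd_of_dvd_mul_left h1

end Helpers

/-! ## §1 The rank of a CM type of a finite abelian group with `g^{2^{K+1}m} = 1`: Kubota's defect by kernels, every index class decided -/

section RankFormula

/-- **THE RANK OF A CM TYPE BY KERNELS — ANY FINITE ABELIAN GROUP** (`g^{2^{K+1}m} = 1` on `G`, `m` odd; conjugation `ρ`, CM type `T`, `T ⊔ ρT = G`):

  `rank(T) + #B₂ + Σ_{j=2}^{K+1} φ(2^j)·#B_{2^j} + Σ_{j=1}^{K+1} Σ_{d ∣ m, d ≠ 1} φ(2^j d)·#B_{2^j,d} = |G|/2 + 1`,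

`B₂` = index-`2` subgroups `H ∌ ρ` splitting `T` evenly (Dodson); `B_{2^j}` = index-`2^j` subgroups `H ∌ ρ` with CYCLIC quotient meeting every coset in `|H|/2`
elements of `T` (Yanai); `B_{2^j,d}` = index-`2^j d` subgroups `H ∌ ρ` with CYCLIC quotient at which the mixed differences of the coset counts of `T` along the prime
torsion of the odd part vanish from every base point (the lane's F66j).  Kubota's defect over the admissible kernels, partitioned by `H ↦ (v₂[G:H], oddpart[G:H])`.
[cite: Kubota1965, §4 Lemma 2] [cite: White1993SporadicCycles, §4, proof of Lemma 3 (p. 131)] [cite: Dodson1984, §3.1.1 Theorem] [cite: Yanai2015IndexDegeneracy, Thm. 4.1]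
[cite: Hazama2003CyclicCM, Prop. 4.3, Lemma 4.6.1 and Thm. 4.8] [cite: LamLeung2000, Thm. 2.2] -/
theorem typeRank_add_card_kernels_eq_of_exponent (hodd : ¬ 2 ∣ m) (h : IsCMTypeWith ρ (T : Set G)) (hexp : ∀ g : G, g ^ (2 ^ (K + 1) * m) = 1) :
    typeRank G (T : Set G) +
      ((Finset.univ : Finset (Subgroup G)).filter fun H => ρ ∉ H ∧ H.index = 2 ∧
        (T.filter fun s => s ∈ H).card = (T.filter fun s => s ∉ H).card).card +
      ∑ j ∈ Finset.Icc 2 (K + 1), (2 ^ j).totient *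
        ((Finset.univ : Finset (Subgroup G)).filter fun H : Subgroup G => ρ ∉ H ∧ H.index = 2 ^ j ∧ IsCyclic (G ⧸ H) ∧
          ∀ g : G, 2 * ((T.filter fun s => g⁻¹ * s ∈ H).card) = Nat.card H).card +
      ∑ j ∈ Finset.Icc 1 (K + 1), ∑ d ∈ m.divisors.erase 1, (2 ^ j * d).totient *
          ((Finset.univ : Finset (Subgroup G)).filter fun H => ρ ∉ H ∧ H.index = 2 ^ j * d ∧ IsCyclic (G ⧸ H) ∧
            ∀ (g : G) (x : ↥d.primeFactors → G), (∀ q, x q ^ (q : ℕ) ∈ H) →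
              ∑ ε : ↥d.primeFactors → Bool, (∏ q, (if ε q then (-1 : ℤ) else 1)) *
                ((T.filter fun s => (g * ∏ q, (if ε q then x q else 1))⁻¹ * s ∈ H).card : ℤ) = 0).card =
      Fintype.card G / 2 + 1 := by
  have hρ2 : ρ * ρ = 1 := rho_mul_rho_rk h
  have key := typeRank_add_sum_totient_eq h
  have hm0 : m ≠ 0 := by
    rintro rfl
    exact hodd (dvd_zero 2)
  set A := (Finset.univ : Finset (Subgroup G)).filter (fun H => ρ ∉ H ∧ IsCyclic (G ⧸ H) ∧
    ∀ χ : AddChar (Additive G) ℂ, (∀ g : G, χ (Additive.ofMul g) = 1 ↔ g ∈ H) →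
      ∑ s ∈ T, χ (Additive.ofMul s) = 0) with hA
  set B₂ := (Finset.univ : Finset (Subgroup G)).filter (fun H => ρ ∉ H ∧ H.index = 2 ∧
    (T.filter fun s => s ∈ H).card = (T.filter fun s => s ∉ H).card) with hB₂
  set Bp : ℕ → Finset (Subgroup G) := fun j => (Finset.univ : Finset (Subgroup G)).filter fun H : Subgroup G =>
      ρ ∉ H ∧ H.index = 2 ^ j ∧ IsCyclic (G ⧸ H) ∧ ∀ g : G, 2 * ((T.filter fun s => g⁻¹ * s ∈ H).card) = Nat.card H with hBp
  set Bd : ℕ → ℕ → Finset (Subgroup G) := fun j d => (Finset.univ : Finset (Subgroup G)).filter fun H =>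
      ρ ∉ H ∧ H.index = 2 ^ j * d ∧ IsCyclic (G ⧸ H) ∧
        ∀ (g : G) (x : ↥d.primeFactors → G), (∀ q, x q ^ (q : ℕ) ∈ H) →
          ∑ ε : ↥d.primeFactors → Bool, (∏ q, (if ε q then (-1 : ℤ) else 1)) *
            ((T.filter fun s => (g * ∏ q, (if ε q then x q else 1))⁻¹ * s ∈ H).card : ℤ) = 0 with hBd
  -- the class map `H ↦ (v₂[G:H], oddpart[G:H])`
  set cls : Subgroup G → ℕ × ℕ := fun H => (H.index.factorization 2, ordCompl[2] H.index) with hcls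
  have hclsOf : ∀ (j d : ℕ) (H : Subgroup G), ¬ 2 ∣ d → H.index = 2 ^ j * d → cls H = (j, d) := by
    intro j d H hd hidx
    have hd0 : d ≠ 0 := by rintro rfl; exact hd (dvd_zero 2)
    rw [hcls]
    dsimp only
    rw [hidx, Nat.ordCompl_pow_mul_of_not_dvd j Nat.prime_two hd, Nat.factorization_mul (pow_ne_zero _ two_ne_zero) hd0,
      Finsupp.add_apply, Nat.Prime.factorization_pow Nat.prime_two, Finsupp.single_eq_same, Nat.factorization_eq_zero_of_not_dvd hd, add_zero]
  have hmaps : ∀ H ∈ A, cls H ∈ Finset.Icc 1 (K + 1) ×ˢ m.divisors := by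
    intro H hH
    rw [hA, Finset.mem_filter] at hH
    obtain ⟨-, -, hj, hd⟩ := index_eq_two_pow_mul_of_exponent hodd hexp hH.2.1 hρ2 hH.2.2.1
    exact Finset.mem_product.2 ⟨hj, Nat.mem_divisors.2 ⟨hd, hm0⟩⟩
  have hidxA : ∀ H ∈ A, H.index = 2 ^ (cls H).1 * (cls H).2 := by
    intro H hH
    rw [hA, Finset.mem_filter] at hH
    exact (index_eq_two_pow_mul_of_exponent hodd hexp hH.2.1 hρ2 hH.2.2.1).1
  have hdodd : ∀ d ∈ m.divisors, ¬ 2 ∣ d := fun d hd h2 => hodd (h2.trans (Nat.dvd_of_mem_divisors hd))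
  -- §A the fibre over `(1, 1)`: index `2`, even splitting
  have hfib11 : A.filter (fun H => cls H = (1, 1)) = B₂ := by
    rw [hA, hB₂, Finset.filter_filter]
    refine Finset.filter_congr fun H _ => ?_
    constructor
    · rintro ⟨⟨hρH, hcyc, hchar⟩, hc⟩
      have hidx : H.index = 2 := by
        have := (index_eq_two_pow_mul_of_exponent hodd hexp hρH hρ2 hcyc).1
        rw [show ordCompl[2] H.index = 1 from congrArg Prod.snd hc, show H.index.factorization 2 = 1 from congrArg Prod.fst hc] at this
        simpa using this
      exact ⟨hρH, hidx, (forall_sum_char_eq_zero_iff_of_index_two hρ2 hρH hidx T).1 hchar⟩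
    · rintro ⟨hρH, hidx, hsplit⟩
      haveI : Fact (Nat.Prime 2) := ⟨Nat.prime_two⟩
      have hcyc : IsCyclic (G ⧸ H) := isCyclic_of_prime_card (p := 2) (by rw [← Subgroup.index_eq_card, hidx])
      exact ⟨⟨hρH, hcyc, (forall_sum_char_eq_zero_iff_of_index_two hρ2 hρH hidx T).2 hsplit⟩,
        hclsOf 1 1 H (by norm_num) (by rw [hidx]; norm_num)⟩
  -- §B the fibres over `(j, 1)`, `j ≥ 2`: index `2^j`, halving every coset
  have hfibj1 : ∀ j ∈ Finset.Icc 2 (K + 1), A.filter (fun H => cls H = (j, 1)) = Bp j := by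
    intro j hj
    obtain ⟨n, rfl⟩ : ∃ n, j = n + 2 := ⟨j - 2, by have := (Finset.mem_Icc.1 hj).1; omega⟩
    rw [hA, hBp, Finset.filter_filter]
    refine Finset.filter_congr fun H _ => ?_
    constructor
    · rintro ⟨⟨hρH, hcyc, hchar⟩, hc⟩
      have hidx : H.index = 2 ^ (n + 2) := by
        have := (index_eq_two_pow_mul_of_exponent hodd hexp hρH hρ2 hcyc).1
        rw [show ordCompl[2] H.index = 1 from congrArg Prod.snd hc, show H.index.factorization 2 = n + 2 from congrArg Prod.fst hc,
          mul_one] at this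
        exact this
      exact ⟨hρH, hidx, hcyc, (forall_sum_char_eq_zero_iff_forall_two_mul_card_eq_of_index_two_pow h hρH (n := n + 1) hidx hcyc).1 hchar⟩
    · rintro ⟨hρH, hidx, hcyc, hhalf⟩
      exact ⟨⟨hρH, hcyc, (forall_sum_char_eq_zero_iff_forall_two_mul_card_eq_of_index_two_pow h hρH (n := n + 1) hidx hcyc).2 hhalf⟩,
        hclsOf (n + 2) 1 H (by norm_num) (by rw [hidx, mul_one])⟩
  -- §C the fibres over `(j, d)`, `d ≠ 1`: index `2^j d`, mixed differences from every base point
  have hfibjd : ∀ j ∈ Finset.Icc 1 (K + 1), ∀ d ∈ m.divisors, d ≠ 1 → A.filter (fun H => cls H = (j, d)) = Bd j d := by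
    intro j hj d hd hd1
    have hd2 := hdodd d hd
    obtain ⟨k, rfl⟩ : ∃ k, j = k + 1 := ⟨j - 1, by have := (Finset.mem_Icc.1 hj).1; omega⟩
    rw [hA, hBd, Finset.filter_filter]
    refine Finset.filter_congr fun H _ => ?_
    constructor
    · rintro ⟨⟨hρH, hcyc, hchar⟩, hc⟩
      have hidx : H.index = 2 ^ (k + 1) * d := by
        have := (index_eq_two_pow_mul_of_exponent hodd hexp hρH hρ2 hcyc).1
        rw [show ordCompl[2] H.index = d from congrArg Prod.snd hc, show H.index.factorization 2 = k + 1 from congrArg Prod.fst hc] at this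
        exact this
      exact ⟨hρH, hidx, hcyc, (forall_sum_char_eq_zero_iff_alternatingSum_of_index_two_pow_mul_odd k hd1 hd2 h hρH hcyc hidx).1 hchar⟩
    · rintro ⟨hρH, hidx, hcyc, hcrit⟩
      exact ⟨⟨hρH, hcyc, (forall_sum_char_eq_zero_iff_alternatingSum_of_index_two_pow_mul_odd k hd1 hd2 h hρH hcyc hidx).2 hcrit⟩,
        hclsOf (k + 1) d H hd2 hidx⟩
  -- §D Euler's `φ` summed by classes
  have hsum : ∑ H ∈ A, H.index.totient =
      ∑ c ∈ Finset.Icc 1 (K + 1) ×ˢ m.divisors, (2 ^ c.1 * c.2).totient * (A.filter fun H => cls H = c).card := by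
    rw [← Finset.sum_fiberwise_of_maps_to hmaps]
    refine Finset.sum_congr rfl fun c _ => ?_
    have hconst : ∀ H ∈ A.filter (fun H => cls H = c), H.index.totient = (2 ^ c.1 * c.2).totient := by
      intro H hH
      rw [Finset.mem_filter] at hH
      rw [hidxA H hH.1, hH.2]
    rw [Finset.sum_congr rfl hconst, Finset.sum_const, smul_eq_mul, mul_comm]
  have hprodsum : ∑ c ∈ Finset.Icc 1 (K + 1) ×ˢ m.divisors, (2 ^ c.1 * c.2).totient * (A.filter fun H => cls H = c).card =
      ∑ j ∈ Finset.Icc 1 (K + 1), ((2 ^ j).totient * (A.filter fun H => cls H = (j, 1)).card +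
        ∑ d ∈ m.divisors.erase 1, (2 ^ j * d).totient * (A.filter fun H => cls H = (j, d)).card) := by
    rw [Finset.sum_product]
    refine Finset.sum_congr rfl fun j _ => ?_
    rw [Finset.sum_eq_add_sum_sdiff_singleton_of_mem (Nat.one_mem_divisors.2 hm0), mul_one, Finset.sdiff_singleton_eq_erase]
  have hIcc : Finset.Icc 1 (K + 1) \ {1} = Finset.Icc 2 (K + 1) := by
    ext j
    simp only [Finset.mem_sdiff, Finset.mem_Icc, Finset.mem_singleton]
    omega
  have hsplitj : ∑ j ∈ Finset.Icc 1 (K + 1), (2 ^ j).totient * (A.filter fun H => cls H = (j, 1)).card =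
      B₂.card + ∑ j ∈ Finset.Icc 2 (K + 1), (2 ^ j).totient * (Bp j).card := by
    rw [Finset.sum_eq_add_sum_sdiff_singleton_of_mem (Finset.mem_Icc.2 ⟨le_rfl, by omega⟩ : 1 ∈ Finset.Icc 1 (K + 1)), pow_one, Nat.totient_two, one_mul,
      hfib11, hIcc]
    congr 1
    exact Finset.sum_congr rfl fun j hj => by rw [hfibj1 j hj]
  have hsplitd : ∑ j ∈ Finset.Icc 1 (K + 1), ∑ d ∈ m.divisors.erase 1, (2 ^ j * d).totient * (A.filter fun H => cls H = (j, d)).card =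
      ∑ j ∈ Finset.Icc 1 (K + 1), ∑ d ∈ m.divisors.erase 1, (2 ^ j * d).totient * (Bd j d).card :=
    Finset.sum_congr rfl fun j hj => Finset.sum_congr rfl fun d hd => by
      rw [hfibjd j hj d (Finset.mem_of_mem_erase hd) (Finset.ne_of_mem_erase hd)]
  rw [hsum, hprodsum, Finset.sum_add_distrib, hsplitj, hsplitd, ← add_assoc, ← add_assoc] at key
  simpa only [hB₂, hBp, hBd] using key

/-- **NONDEGENERACY CRITERION — ANY FINITE ABELIAN GROUP** (`g^{2^{K+1}m} = 1`, `m` odd): `T` is NONDEGENERATE (`rank = |G|/2 + 1`) iff NO index-`2` subgroup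
`H ∌ ρ` splits `T` evenly, for `2 ≤ j ≤ K+1` NO index-`2^j` subgroup `H ∌ ρ` with cyclic quotient meets every coset in `|H|/2` elements of `T`, and for
`1 ≤ j ≤ K+1` and every divisor `d ≠ 1` of `m` NO index-`2^j d` subgroup `H ∌ ρ` with cyclic quotient has vanishing mixed differences of the coset counts along
the prime torsion of the odd part. [cite: Kubota1965, §4 Lemma 2] [cite: Dodson1984, §3.1.1 Theorem] [cite: Yanai2015IndexDegeneracy, Thm. 4.1]
[cite: Hazama2003CyclicCM, Prop. 4.3 and Thm. 4.8] -/
theorem typeRank_eq_iff_of_exponent (hodd : ¬ 2 ∣ m) (h : IsCMTypeWith ρ (T : Set G)) (hexp : ∀ g : G, g ^ (2 ^ (K + 1) * m) = 1) :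
    typeRank G (T : Set G) = Fintype.card G / 2 + 1 ↔
      (∀ H : Subgroup G, ρ ∉ H → H.index = 2 → (T.filter fun s => s ∈ H).card ≠ (T.filter fun s => s ∉ H).card) ∧
      (∀ j ∈ Finset.Icc 2 (K + 1), ∀ H : Subgroup G, ρ ∉ H → H.index = 2 ^ j → IsCyclic (G ⧸ H) →
        ¬ ∀ g : G, 2 * ((T.filter fun s => g⁻¹ * s ∈ H).card) = Nat.card H) ∧
      (∀ j ∈ Finset.Icc 1 (K + 1), ∀ d : ℕ, d ∣ m → d ≠ 1 → ∀ H : Subgroup G, ρ ∉ H → H.index = 2 ^ j * d → IsCyclic (G ⧸ H) →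
        ¬ ∀ (g : G) (x : ↥d.primeFactors → G), (∀ q, x q ^ (q : ℕ) ∈ H) →
          ∑ ε : ↥d.primeFactors → Bool, (∏ q, (if ε q then (-1 : ℤ) else 1)) *
            ((T.filter fun s => (g * ∏ q, (if ε q then x q else 1))⁻¹ * s ∈ H).card : ℤ) = 0) := by
  have key := typeRank_add_card_kernels_eq_of_exponent hodd h hexp
  have hm0 : m ≠ 0 := by
    rintro rfl
    exact hodd (dvd_zero 2)
  set b₂ := ((Finset.univ : Finset (Subgroup G)).filter fun H => ρ ∉ H ∧ H.index = 2 ∧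
        (T.filter fun s => s ∈ H).card = (T.filter fun s => s ∉ H).card).card with hb₂
  set cp : ℕ → ℕ := fun j => ((Finset.univ : Finset (Subgroup G)).filter fun H : Subgroup G => ρ ∉ H ∧ H.index = 2 ^ j ∧ IsCyclic (G ⧸ H) ∧
          ∀ g : G, 2 * ((T.filter fun s => g⁻¹ * s ∈ H).card) = Nat.card H).card with hcp
  set cd : ℕ → ℕ → ℕ := fun j d => ((Finset.univ : Finset (Subgroup G)).filter fun H => ρ ∉ H ∧ H.index = 2 ^ j * d ∧ IsCyclic (G ⧸ H) ∧
            ∀ (g : G) (x : ↥d.primeFactors → G), (∀ q, x q ^ (q : ℕ) ∈ H) →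
              ∑ ε : ↥d.primeFactors → Bool, (∏ q, (if ε q then (-1 : ℤ) else 1)) *
                ((T.filter fun s => (g * ∏ q, (if ε q then x q else 1))⁻¹ * s ∈ H).card : ℤ) = 0).card with hcd
  have key' : typeRank G (T : Set G) + (b₂ + ∑ j ∈ Finset.Icc 2 (K + 1), (2 ^ j).totient * cp j +
      ∑ j ∈ Finset.Icc 1 (K + 1), ∑ d ∈ m.divisors.erase 1, (2 ^ j * d).totient * cd j d) = Fintype.card G / 2 + 1 := by
    rw [← key]; ring
  have hiff : typeRank G (T : Set G) = Fintype.card G / 2 + 1 ↔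
      b₂ = 0 ∧ (∀ j ∈ Finset.Icc 2 (K + 1), (2 ^ j).totient * cp j = 0) ∧
        ∀ j ∈ Finset.Icc 1 (K + 1), ∑ d ∈ m.divisors.erase 1, (2 ^ j * d).totient * cd j d = 0 := by
    rw [← Finset.sum_eq_zero_iff, ← Finset.sum_eq_zero_iff]
    constructor
    · intro hr
      rw [hr] at key'
      refine ⟨by omega, by omega, by omega⟩
    · rintro ⟨h0, h1, h2⟩
      rw [h0, h1, h2] at key'
      simpa using key'
  rw [hiff]
  have htot : ∀ j d : ℕ, 0 < d → 0 < (2 ^ j * d).totient := fun j d hd => Nat.totient_pos.2 (Nat.mul_pos (by positivity) hd)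
  refine and_congr ?_ (and_congr ?_ ?_)
  · rw [hb₂, Finset.card_eq_zero, Finset.filter_eq_empty_iff]
    constructor
    · intro hno H hρH hidx heq
      exact hno (Finset.mem_univ H) ⟨hρH, hidx, heq⟩
    · rintro hno H - ⟨hρH, hidx, heq⟩
      exact hno H hρH hidx heq
  · refine forall_congr' fun j => forall_congr' fun hj => ?_
    have hpos : 0 < (2 ^ j).totient := Nat.totient_pos.2 (by positivity)
    rw [Nat.mul_eq_zero, or_iff_right hpos.ne', hcp]
    dsimp only
    rw [Finset.card_eq_zero, Finset.filter_eq_empty_iff]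
    constructor
    · intro hno H hρH hidx hcyc hhalf
      exact hno (Finset.mem_univ H) ⟨hρH, hidx, hcyc, hhalf⟩
    · rintro hno H - ⟨hρH, hidx, hcyc, hhalf⟩
      exact hno H hρH hidx hcyc hhalf
  · refine forall_congr' fun j => forall_congr' fun hj => ?_
    rw [Finset.sum_eq_zero_iff]
    constructor
    · intro hno d hd hd1 H hρH hidx hcyc hcrit
      have h0 := hno d (Finset.mem_erase.2 ⟨hd1, Nat.mem_divisors.2 ⟨hd, hm0⟩⟩)
      rw [Nat.mul_eq_zero, or_iff_right (htot j d (Nat.pos_of_dvd_of_pos hd (Nat.pos_of_ne_zero hm0))).ne', hcd] at h0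
      dsimp only at h0
      rw [Finset.card_eq_zero, Finset.filter_eq_empty_iff] at h0
      exact h0 (Finset.mem_univ H) ⟨hρH, hidx, hcyc, hcrit⟩
    · intro hno d hd
      rw [Finset.mem_erase] at hd
      rw [Nat.mul_eq_zero]
      right
      rw [hcd]
      dsimp only
      rw [Finset.card_eq_zero, Finset.filter_eq_empty_iff]
      rintro H - ⟨hρH, hidx, hcyc, hcrit⟩
      exact hno d (Nat.dvd_of_mem_divisors hd.2) hd.1 H hρH hidx hcyc hcrit

end RankFormula

end AbelianKernels

end CyclicCMType

end Literature.NumberTheory.ComplexMultiplication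

end
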